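/-
Copyright (c) 2026 the pub-hodgecm-mathlib formalisation cell (harness21).  Prover seat hodgecm-mathlib-K2Liu-p10 (g3), Track B «K2-LIT»,
#184♮ = hLiu418 = `stmt-HodgeConjecture-24832`; Road Φ of socket #41, organ «Φ4-exact», method «E-det» (LEAD F0P6-plan (g13) 09:54:17Z ∕ 09:57:20Z ∕
10:02:45Z; K2Liu-p12 (g2) interface 10:04:15Z): E4 file 2a — the SPLIT-PLACE TRANSPORT of the skew lattice `S` to matrices over `F_v` along `w₀`.
THEOREMS ONLY (no `def`, no `instance`, no named-fact hypothesis, no `sorry`).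
-/
import Summits.HodgeConjecture.HodgeConjecture.Theorems.K2LiuSkewLatticeShells             -- ★ the skew-lattice frame (`gramS`, `gramS_transpose`, `isUnit_det_gramS'` via imports)
import Summits.HodgeConjecture.HodgeConjecture.Theorems.K2LiuWhittakerCharacterMoves        -- ★ `map_conj_eq_of_skew`
import Literature.NumberTheory.GelbartRogawski1991.LocalUnitarySplitPlaceDarboux             -- ★ `splitIdem`, `splitCoord`, `toPlace_surjective`, `valued_toPlace_of_split`
import HarnessLib

/-!
# Crux `HLiu418`, Road Φ, organ «Φ4-exact» (E-det), E4 file 2a: THE SKEW LATTICE AT A SPLIT PLACE IS `M₂(F_v)` READ AT `w₀`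

Cell `hodgecm-mathlib`, crux item hLiu418 = `stmt-HodgeConjecture-24832` (helper lane, count-neutral).  Frame of ★ `K2LiuGoodPlaceWhittakerBound` with `n = 2`:
`S ⊂ M₂(E ⊗ F_v)` the `T`-skew matrices (`σ(t)ᵀT + Tt = 0`, `T = gramS = T₀ ⊗ 1`), `v` a place of `F` SPLIT in `E`: `w₀ ∣ v` with `c • w₀ ≠ w₀`, so the
places above `v` are `w₀` and `w̄₀ = c⁻¹ • w₀` (★ `PlacesOver.eq_or_eq_galInv`) and `ι_{w₀} : F_v ≃ E_{w₀}` (★ `toPlace_surjective`, `valued_toPlace_of_split`).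
For `T`-skew `t` the relation `σ t = −T⁻¹tᵀT` (★ `map_conj_eq_of_skew`) read at the component `w₀` expresses the `w̄₀`-components through the `w₀`-components:
* `conjLocal_apply_galInv` — `(σ x)_{w₀} = c_*(x_{w̄₀})`; `galMap_apply_galInv_of_skew` — `c_*(t_{ij,w̄₀}) = (−T⁻¹tᵀT)_{ij,w₀}`;
* **`eq_of_skew_of_apply_eq`** — two `T`-skew matrices with the same `w₀`-components are EQUAL;
* **`ball_of_skew_of_ball_at`** — if the `w₀`-entries of a skew `t` lie in `ball(a)` (and `T, T⁻¹` are integral) then `t ∈ B(a)` (all entries, all places);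
* **`valued_det_galInv_of_skew`** — `|det t|_{w̄₀} = |det t|_{w₀}` (`det` is `σ`-fixed on `S`: `det(−T⁻¹tᵀT) = det t` for `2 × 2`);
* **`exists_skew_of_matrix`** — for every `Y ∈ M₂(F_v)` the matrix `e_{w₀}·ι(Y) + e_{w̄₀}·ι(−T_F⁻¹YᵀT_F)` is `T`-skew with `w₀`-components `ι_{w₀}(Y_{ij})`
  (`e_w` = ★ `splitIdem`, `T_F = T₀ ⊗_F F_v`); `exists_coords_of_skew` — every skew `t` has `w₀`-coordinates `Y` (`ι_{w₀}(Y_{ij}) = t_{ij,w₀}`, ★ `splitCoord`);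
* **`toPlace_tau_trace_mul`** — for skew `β, t` with `w₀`-coordinates `b, Y`: `τ(tr(βt)) = 2·tr(bY)` (`tr(βt)` is `σ`-fixed, `ι(τ r) = r + σ r`);
  `det_apply_eq_toPlace_det` — `(det t)_{w₀} = ι_{w₀}(det Y)`.
Consumer: E4 file 2b `K2LiuSkewResidueQuadricSplit` (the value `I(1,1) = −q_v μ(B(0))` of K2Liu-p12 (g2)'s «E-det» census at a split place).
Sources: [CasselsFrohlichANT1967, Ch. II §10, Ch. VII §1.1]; [Mok2014, §1 (`U(N)(F_v) ≅ GL_N(E_w)` at split `v`)]; [KudlaRallis1994, §2].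
HONEST LABEL.  Helper lemmas, count-neutral; `HC_CM` is proved only modulo the 7 printed citations (2 remaining named inputs:
hLiu418 = `stmt-HodgeConjecture-24832`, h413 = `stmt-HodgeConjecture-24833`) until rung 0 closes.
-/

set_option autoImplicit false
set_option linter.dupNamespace false -- the mandated namespace repeats `HodgeConjecture.HodgeConjecture`

noncomputable section

open scoped Matrix
open NumberField IsDedekindDomain Matrix
open Literature.NumberTheory.Automorphic Literature.NumberTheory.Automorphic.UnitaryGroup
open Literature.NumberTheory.GelbartRogawski1991.UnitaryDualPair.LocalSplitting
open Summit.HodgeConjecture.HodgeConjecture.Cruxes.HLiu418.K2LiuWhittakerCharacterMoves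

namespace Summit.HodgeConjecture.HodgeConjecture.Cruxes.HLiu418.K2LiuSkewLatticeSplitTransport

variable (F : Type) [Field F] [NumberField F] (E : Type) [Field E] [NumberField E] [Algebra F E]
  [Algebra.IsQuadraticExtension F E] (c : E ≃ₐ[F] E)
  {δ : E} (hcδ : c δ = -δ) (hδ : δ ≠ 0) {dd : F} (hd : δ * δ = algebraMap F E dd)
  (v : HeightOneSpectrum (𝓞 F)) {T₀ : Matrix (Fin 2) (Fin 2) F} (hT₀ : T₀.IsSymm) (hT₀d : IsUnit T₀.det)
  {π : v.adicCompletion F} (w₀ : PlacesOver E v) (hw₀ : c • w₀.1 ≠ w₀.1)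

/-! ## 1. Components at the two places above a split `v` -/

omit [NumberField F] [NumberField E] [Algebra.IsQuadraticExtension F E] in
include hw₀ in
/-- `c ≠ 1` at a split place. [folklore] -/
theorem conj_ne_one : c ≠ 1 := fun h => hw₀ (by rw [h, one_smul])

include hw₀ in
/-- every place above `v` is `w₀` or `w̄₀ = c⁻¹ • w₀` (★ `PlacesOver.eq_or_eq_galInv`). [cite: CasselsFrohlichANT1967, Ch. VII §1.1] -/
theorem eq_or_eq_galInv (w : PlacesOver E v) : w = w₀ ∨ w = PlacesOver.galInv c w₀ :=
  PlacesOver.eq_or_eq_galInv (c := c) (conj_ne_one F E c v w₀ hw₀) w₀ w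

omit [Algebra.IsQuadraticExtension F E] in
/-- `(σ x)_{w₀} = c_*(x_{w̄₀})` (definitional, ★ `conjLocal_apply`). [cite: CasselsFrohlichANT1967, Ch. VII §1.1] -/
theorem conjLocal_apply_self (x : LocalRing E v) :
    conjLocal E c v x w₀ = galAdicCompletionMap c (smul_inv_smul c w₀.1) (x (PlacesOver.galInv c w₀)) := rfl

omit [Algebra.IsQuadraticExtension F E] in
include hw₀ in
/-- the idempotent `e_{w₀}` is `1` at `w₀` and `0` at `w̄₀`; `e_{w̄₀}` is `0` at `w₀`. [folklore] -/
theorem splitIdem_apply_facts :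
    splitIdem F E v w₀ w₀ = 1 ∧ splitIdem F E v (PlacesOver.galInv c w₀) w₀ = 0 ∧ splitIdem F E v w₀ (PlacesOver.galInv c w₀) = 0 ∧
      splitIdem F E v (PlacesOver.galInv c w₀) (PlacesOver.galInv c w₀) = 1 := by
  have hne : PlacesOver.galInv c w₀ ≠ w₀ := PlacesOver.galInv_ne c w₀ hw₀
  simp only [splitIdem, if_true, hne, hne.symm, if_false, and_self]

include hw₀ in
/-- `σ(e_{w₀}) = e_{w̄₀}` and `σ(e_{w̄₀}) = e_{w₀}`. [folklore] -/
theorem conjLocal_splitIdem :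
    conjLocal E c v (splitIdem F E v w₀) = splitIdem F E v (PlacesOver.galInv c w₀) ∧
      conjLocal E c v (splitIdem F E v (PlacesOver.galInv c w₀)) = splitIdem F E v w₀ := by
  have hc := conj_ne_one F E c v w₀ hw₀
  have hne : PlacesOver.galInv c w₀ ≠ w₀ := PlacesOver.galInv_ne c w₀ hw₀
  have hgg : PlacesOver.galInv c (PlacesOver.galInv c w₀) = w₀ := PlacesOver.galInv_galInv (c := c) hc w₀
  constructor
  · funext w
    rcases eq_or_eq_galInv F E c v w₀ hw₀ w with rfl | rfl
    · rw [conjLocal_apply]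
      show galAdicCompletionMap c _ (splitIdem F E v w (PlacesOver.galInv c w)) = _
      simp only [splitIdem, hne, hne.symm, if_false, map_zero]
    · rw [conjLocal_apply]
      show galAdicCompletionMap c _ (splitIdem F E v w₀ (PlacesOver.galInv c (PlacesOver.galInv c w₀))) = _
      simp only [splitIdem, hgg, if_true, map_one]
  · funext w
    rcases eq_or_eq_galInv F E c v w₀ hw₀ w with rfl | rfl
    · rw [conjLocal_apply]
      show galAdicCompletionMap c _ (splitIdem F E v (PlacesOver.galInv c w) (PlacesOver.galInv c w)) = _
      simp only [splitIdem, if_true, map_one]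
    · rw [conjLocal_apply]
      show galAdicCompletionMap c _ (splitIdem F E v (PlacesOver.galInv c w₀) (PlacesOver.galInv c (PlacesOver.galInv c w₀))) = _
      simp only [splitIdem, hgg, hne, hne.symm, if_false, map_zero]

/-! ## 2. The skew relation read at `w₀` -/

omit [Algebra.IsQuadraticExtension F E] in
include hT₀ hT₀d in
/-- **`c_*(t_{ij,w̄₀}) = (−T⁻¹tᵀT)_{ij,w₀}`** for a `T`-skew `t` (★ `map_conj_eq_of_skew` at the component `w₀`). [cite: KudlaRallis1994, §2] -/
theorem galMap_apply_galInv_of_skew {t : Matrix (Fin 2) (Fin 2) (LocalRing E v)}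
    (ht : (t.map (conjLocal E c v))ᵀ * gramS F E v 2 T₀ + gramS F E v 2 T₀ * t = 0) (i j : Fin 2) :
    galAdicCompletionMap c (smul_inv_smul c w₀.1) (t i j (PlacesOver.galInv c w₀)) =
      (-((gramS F E v 2 T₀)⁻¹ * tᵀ * gramS F E v 2 T₀)) i j w₀ := by
  have h := map_conj_eq_of_skew F E c v (isUnit_det_gramS' F E v 2 hT₀d) (gramS_transpose F E v 2 hT₀) ht
  have hij := congrFun (congrFun (congrFun h i) j) w₀
  rw [Matrix.map_apply] at hij
  exact hij

include hw₀ hT₀ hT₀d in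
/-- **two `T`-skew matrices with the same `w₀`-components are equal** (their difference is skew with vanishing `w₀`-part, whose `w̄₀`-part is
`c_*⁻¹` of `(−T⁻¹uᵀT)_{w₀} = 0`). [cite: Mok2014, §1] -/
theorem eq_of_skew_of_apply_eq {t t' : Matrix (Fin 2) (Fin 2) (LocalRing E v)}
    (ht : (t.map (conjLocal E c v))ᵀ * gramS F E v 2 T₀ + gramS F E v 2 T₀ * t = 0)
    (ht' : (t'.map (conjLocal E c v))ᵀ * gramS F E v 2 T₀ + gramS F E v 2 T₀ * t' = 0)
    (h : ∀ i j, t i j w₀ = t' i j w₀) : t = t' := by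
  have hc := conj_ne_one F E c v w₀ hw₀
  rw [← sub_eq_zero]
  have hu : ((t - t').map (conjLocal E c v))ᵀ * gramS F E v 2 T₀ + gramS F E v 2 T₀ * (t - t') = 0 := by
    rw [show (t - t').map (conjLocal E c v) = t.map (conjLocal E c v) - t'.map (conjLocal E c v) from
        Matrix.ext fun i j => map_sub (conjLocal E c v) (t i j) (t' i j),
      Matrix.transpose_sub, Matrix.sub_mul, Matrix.mul_sub, sub_add_sub_comm, ht, ht', sub_zero]
  have hu0 : ∀ i j, (t - t') i j w₀ = 0 := fun i j => by rw [Matrix.sub_apply, Pi.sub_apply, h, sub_self]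
  refine Matrix.ext fun i j => funext fun w => ?_
  rcases eq_or_eq_galInv F E c v w₀ hw₀ w with rfl | rfl
  · exact hu0 i j
  · have hg := galMap_apply_galInv_of_skew F E c v hT₀ hT₀d w₀ hu i j
    -- the right-hand side only involves `w₀`-components of `t − t'`, which vanish
    have hrhs : (-((gramS F E v 2 T₀)⁻¹ * (t - t')ᵀ * gramS F E v 2 T₀)) i j w₀ = 0 := by
      rw [Matrix.neg_apply, Pi.neg_apply, neg_eq_zero, Matrix.mul_apply, Finset.sum_apply]
      refine Finset.sum_eq_zero fun k _ => ?_
      rw [Pi.mul_apply, Matrix.mul_apply, Finset.sum_apply, Finset.sum_eq_zero fun l _ => ?_, zero_mul]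
      rw [Pi.mul_apply, Matrix.transpose_apply, hu0, mul_zero]
    rw [hrhs, map_eq_zero] at hg
    rw [Matrix.zero_apply, Pi.zero_apply]
    exact hg

omit [Algebra.IsQuadraticExtension F E] in
/-- single-place ultrametric bound: if the `w`-entries of `P`, `M`, `Q` lie in the balls `a`, `b`, `d` then those of `P M Q` lie in `ball(a+b+d)`.
[cite: CasselsFrohlichANT1967, Ch. II §10] -/
theorem valued_mul_mul_apply_le {P M Q : Matrix (Fin 2) (Fin 2) (LocalRing E v)} (w : PlacesOver E v) {a b d : ℤ}
    (hP : ∀ i j, Valued.v (P i j w) ≤ Valued.v (toPlace v w π) ^ a) (hM : ∀ i j, Valued.v (M i j w) ≤ Valued.v (toPlace v w π) ^ b)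
    (hQ : ∀ i j, Valued.v (Q i j w) ≤ Valued.v (toPlace v w π) ^ d) (hπ0 : Valued.v (toPlace v w π) ≠ 0) (i j : Fin 2) :
    Valued.v ((P * M * Q) i j w) ≤ Valued.v (toPlace v w π) ^ (a + b + d) := by
  rw [Matrix.mul_apply, Finset.sum_apply]
  refine Valuation.map_sum_le _ fun k _ => ?_
  rw [Pi.mul_apply, map_mul, Matrix.mul_apply, Finset.sum_apply, zpow_add₀ hπ0]
  refine mul_le_mul' (Valuation.map_sum_le _ fun l _ => ?_) (hQ k j)
  rw [Pi.mul_apply, map_mul, zpow_add₀ hπ0]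
  exact mul_le_mul' (hP i l) (hM l k)

include hw₀ hT₀ hT₀d in
/-- **`w₀`-entries control all entries of a skew matrix**: if `T`, `T⁻¹` are integral and the `w₀`-entries of a `T`-skew `t` lie in `ball(a)`, then
`t ∈ B(a)` — at `w̄₀` the entries are `c_*⁻¹((−T⁻¹tᵀT)_{w₀})` and `c_*` preserves valuations, the thresholds being Galois-invariant.
[cite: CasselsFrohlichANT1967, Ch. II §10, Ch. VII §1.1] -/
theorem ball_of_skew_of_ball_at (hπ : Valued.v π = WithZero.exp (-1 : ℤ))
    (hTb : ∀ i j (w : PlacesOver E v), Valued.v (gramS F E v 2 T₀ i j w) ≤ Valued.v (toPlace v w π) ^ (0 : ℤ))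
    (hTib : ∀ i j (w : PlacesOver E v), Valued.v ((gramS F E v 2 T₀)⁻¹ i j w) ≤ Valued.v (toPlace v w π) ^ (0 : ℤ))
    {t : Matrix (Fin 2) (Fin 2) (LocalRing E v)} (ht : (t.map (conjLocal E c v))ᵀ * gramS F E v 2 T₀ + gramS F E v 2 T₀ * t = 0)
    {a : ℤ} (hw : ∀ i j, Valued.v (t i j w₀) ≤ Valued.v (toPlace v w₀ π) ^ a) :
    ∀ i j (w : PlacesOver E v), Valued.v (t i j w) ≤ Valued.v (toPlace v w π) ^ a := by
  intro i j w
  rcases eq_or_eq_galInv F E c v w₀ hw₀ w with rfl | rfl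
  · exact hw i j
  · have hg := galMap_apply_galInv_of_skew F E c v hT₀ hT₀d w₀ ht i j
    have hval : Valued.v (t i j (PlacesOver.galInv c w₀)) = Valued.v ((-((gramS F E v 2 T₀)⁻¹ * tᵀ * gramS F E v 2 T₀)) i j w₀) := by
      rw [← hg, valued_galAdicCompletionMap]
    have hthr : Valued.v (toPlace v (PlacesOver.galInv c w₀) π) = Valued.v (toPlace v w₀ π) :=
      (K2LiuLocalRingValuationBalls.valued_toPlace_uniformizer_gal F E v c (PlacesOver.galInv c w₀) w₀ (smul_inv_smul c w₀.1) π).symm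
    rw [hval, hthr, Matrix.neg_apply, Pi.neg_apply, Valuation.map_neg]
    have h := valued_mul_mul_apply_le F E v w₀ (P := (gramS F E v 2 T₀)⁻¹) (M := tᵀ) (Q := gramS F E v 2 T₀) (fun i j => hTib i j w₀)
      (fun i j => hw j i) (fun i j => hTb i j w₀) (K2LiuLocalRingValuationBalls.valued_toPlace_uniformizer_ne_zero F E v hπ w₀) i j
    rwa [zero_add, add_zero] at h

omit [Algebra.IsQuadraticExtension F E] in
include hT₀ hT₀d in
/-- **`|det t|_{w̄₀} = |det t|_{w₀}` for a `T`-skew `t`**: `σ(det t) = det(σ t) = det(−T⁻¹tᵀT) = det t` (`2 × 2`), and `(σ r)_{w₀} = c_*(r_{w̄₀})`.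
[cite: KudlaRallis1994, §2] -/
theorem valued_det_galInv_of_skew {t : Matrix (Fin 2) (Fin 2) (LocalRing E v)}
    (ht : (t.map (conjLocal E c v))ᵀ * gramS F E v 2 T₀ + gramS F E v 2 T₀ * t = 0) :
    Valued.v (t.det (PlacesOver.galInv c w₀)) = Valued.v (t.det w₀) := by
  have hT := isUnit_det_gramS' F E v 2 hT₀d
  have h := map_conj_eq_of_skew F E c v hT (gramS_transpose F E v 2 hT₀) ht
  have hdet : (conjLocal E c v) t.det = t.det := by
    rw [RingHom.map_det, show (conjLocal E c v).mapMatrix t = t.map (conjLocal E c v) from rfl, h, Matrix.det_neg, Matrix.det_mul,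
      Matrix.det_mul, Matrix.det_transpose, Fintype.card_fin]
    rw [mul_comm ((gramS F E v 2 T₀)⁻¹.det) t.det, mul_assoc, Matrix.det_nonsing_inv, Ring.inverse_mul_cancel _ hT]
    ring
  have hw := congrFun hdet w₀
  rw [conjLocal_apply_self] at hw
  rw [← hw, valued_galAdicCompletionMap]

/-! ## 3. Coordinates at `w₀`: every skew matrix comes from `M₂(F_v)`, and conversely -/

include hw₀ hcδ hδ hd in
/-- **every skew `t` has `w₀`-coordinates `Y ∈ M₂(F_v)`**, `ι_{w₀}(Y_{ij}) = t_{ij,w₀}` (★ `splitCoord`, `toPlace_splitCoord`; `ι_{w₀}` is onto at a split place).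
[cite: Mok2014, §1] -/
theorem exists_coords (t : Matrix (Fin 2) (Fin 2) (LocalRing E v)) :
    ∃ Y : Matrix (Fin 2) (Fin 2) (v.adicCompletion F), ∀ i j, toPlace v w₀ (Y i j) = t i j w₀ :=
  ⟨fun i j => splitCoord F E c hcδ hδ v w₀ (t i j), fun i j => toPlace_splitCoord F E c hcδ hδ hd v w₀ hw₀ (t i j)⟩

omit [Algebra.IsQuadraticExtension F E] in
/-- `gramS = (T₀ ⊗_F F_v) ⊗ 1`: the Gram matrix is the `ι_v`-image of the `F_v`-matrix `T_F = T₀.map (algebraMap F F_v)`. [cite: KudlaRallis1994, §2] -/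
theorem gramS_eq_map : gramS F E v 2 T₀ = (T₀.map (algebraMap F (v.adicCompletion F))).map (toLocalRing E v) := rfl

include hw₀ hT₀ hT₀d in
/-- **THE SECTION**: for `Y ∈ M₂(F_v)`, with `T_F = T₀ ⊗ F_v` and `Y′ = −T_F⁻¹ Yᵀ T_F`, the matrix `R(Y) = e_{w₀}·ι_v(Y) + e_{w̄₀}·ι_v(Y′)` is `T`-skew and has
`w₀`-components `ι_{w₀}(Y_{ij})` — the inverse of `t ↦ t_{w₀}`. [cite: Mok2014, §1] [cite: KudlaRallis1994, §2] -/
theorem skew_section (Y : Matrix (Fin 2) (Fin 2) (v.adicCompletion F)) :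
    ((splitIdem F E v w₀ • Y.map (toLocalRing E v) +
        splitIdem F E v (PlacesOver.galInv c w₀) •
          (-((T₀.map (algebraMap F (v.adicCompletion F)))⁻¹ * Yᵀ * T₀.map (algebraMap F (v.adicCompletion F)))).map (toLocalRing E v)).map
          (conjLocal E c v))ᵀ * gramS F E v 2 T₀ +
      gramS F E v 2 T₀ * (splitIdem F E v w₀ • Y.map (toLocalRing E v) +
        splitIdem F E v (PlacesOver.galInv c w₀) •
          (-((T₀.map (algebraMap F (v.adicCompletion F)))⁻¹ * Yᵀ * T₀.map (algebraMap F (v.adicCompletion F)))).map (toLocalRing E v)) = 0 ∧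
    ∀ i j, (splitIdem F E v w₀ • Y.map (toLocalRing E v) +
        splitIdem F E v (PlacesOver.galInv c w₀) •
          (-((T₀.map (algebraMap F (v.adicCompletion F)))⁻¹ * Yᵀ * T₀.map (algebraMap F (v.adicCompletion F)))).map (toLocalRing E v)) i j w₀ =
      toPlace v w₀ (Y i j) := by
  obtain ⟨he1, he2, -, -⟩ := splitIdem_apply_facts F E c v w₀ hw₀
  obtain ⟨hσe, hσe'⟩ := conjLocal_splitIdem F E c v w₀ hw₀
  set TF : Matrix (Fin 2) (Fin 2) (v.adicCompletion F) := T₀.map (algebraMap F (v.adicCompletion F)) with hTF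
  set Y' : Matrix (Fin 2) (Fin 2) (v.adicCompletion F) := -(TF⁻¹ * Yᵀ * TF) with hY'
  have hTFt : TFᵀ = TF := by rw [hTF, ← Matrix.transpose_map, hT₀.eq]
  have hTFu : IsUnit TF.det := by rw [hTF, ← RingHom.mapMatrix_apply, ← RingHom.map_det]; exact hT₀d.map _
  have hT : gramS F E v 2 T₀ = TF.map (toLocalRing E v) := gramS_eq_map F E v
  -- the two `F_v`-identities behind skewness
  have hK1 : TF * Y' = -(Yᵀ * TF) := by
    rw [hY', Matrix.mul_neg, ← Matrix.mul_assoc, ← Matrix.mul_assoc, Matrix.mul_nonsing_inv _ hTFu, Matrix.one_mul]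
  have hK2 : Y'ᵀ * TF = -(TF * Y) := by
    rw [hY', Matrix.transpose_neg, Matrix.transpose_mul, Matrix.transpose_mul, Matrix.transpose_transpose, hTFt, Matrix.transpose_nonsing_inv, hTFt,
      Matrix.neg_mul, Matrix.mul_assoc, Matrix.mul_assoc, Matrix.nonsing_inv_mul _ hTFu, Matrix.mul_one]
  constructor
  · -- `σ` swaps the two idempotents and fixes `ι_v`-images
    have hmapσ : (splitIdem F E v w₀ • Y.map (toLocalRing E v) + splitIdem F E v (PlacesOver.galInv c w₀) • Y'.map (toLocalRing E v)).map
        (conjLocal E c v) = splitIdem F E v (PlacesOver.galInv c w₀) • Y.map (toLocalRing E v) + splitIdem F E v w₀ • Y'.map (toLocalRing E v) := by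
      ext i j
      simp only [Matrix.map_apply, Matrix.add_apply, Matrix.smul_apply, smul_eq_mul, map_add, map_mul, hσe, hσe', conjLocal_toLocalRing]
    rw [hmapσ, hT, Matrix.transpose_add, Matrix.transpose_smul, Matrix.transpose_smul, Matrix.add_mul, Matrix.mul_add, Matrix.smul_mul, Matrix.smul_mul,
      Matrix.mul_smul, Matrix.mul_smul, ← Matrix.transpose_map, ← Matrix.transpose_map, ← Matrix.map_mul, ← Matrix.map_mul, ← Matrix.map_mul,
      ← Matrix.map_mul, hK1, hK2]
    have hmn : ∀ M : Matrix (Fin 2) (Fin 2) (v.adicCompletion F), (-M).map (toLocalRing E v) = -M.map (toLocalRing E v) := fun M =>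
      Matrix.ext fun i j => map_neg (toLocalRing E v) (M i j)
    rw [show Yᵀ * TF = -(TF * Y') by rw [hK1, neg_neg], hmn, hmn, smul_neg, smul_neg]
    abel
  · intro i j
    rw [Matrix.add_apply, Matrix.smul_apply, Matrix.smul_apply, Pi.add_apply, smul_eq_mul, smul_eq_mul, Pi.mul_apply, Pi.mul_apply, he1, he2,
      one_mul, zero_mul, add_zero, Matrix.map_apply, toLocalRing_apply]

/-! ## 4. Determinant and trace pairing through the `w₀`-coordinates -/

omit [Algebra.IsQuadraticExtension F E] in
/-- **`(det t)_{w₀} = ι_{w₀}(det Y)`** when `Y` are the `w₀`-coordinates of `t`. [cite: KudlaRallis1994, §2] -/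
theorem det_apply_eq_toPlace_det {t : Matrix (Fin 2) (Fin 2) (LocalRing E v)} {Y : Matrix (Fin 2) (Fin 2) (v.adicCompletion F)}
    (hY : ∀ i j, toPlace v w₀ (Y i j) = t i j w₀) : t.det w₀ = toPlace v w₀ Y.det := by
  have h1 : t.det w₀ = (t.map (Pi.evalRingHom (fun w : PlacesOver E v => w.1.adicCompletion E) w₀)).det := by
    rw [← RingHom.mapMatrix_apply, ← RingHom.map_det]; rfl
  have h2 : t.map (Pi.evalRingHom (fun w : PlacesOver E v => w.1.adicCompletion E) w₀) = Y.map (toPlace v w₀) :=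
    Matrix.ext fun i j => (hY i j).symm
  rw [h1, h2, ← RingHom.mapMatrix_apply, ← RingHom.map_det]

omit [Algebra.IsQuadraticExtension F E] in
include hT₀ hT₀d in
/-- **THE TRACE PAIRING AT A SPLIT PLACE**: for `T`-skew `β`, `t` with `w₀`-coordinates `b`, `Y`:  `τ(tr(β t)) = 2 · tr(b Y)` (`tr(βt)` is `σ`-fixed since
`σ(βt) = T⁻¹βᵀtᵀT`; `ι_v(τ r) = r + σ r`; read at `w₀`, where `ι_{w₀}` is injective). [cite: KudlaRallis1994, §2] -/
theorem tau_trace_mul_eq {τ : LocalRing E v → v.adicCompletion F} (hτ : ∀ r, toLocalRing E v (τ r) = r + conjLocal E c v r)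
    {β t : Matrix (Fin 2) (Fin 2) (LocalRing E v)}
    (hβ : (β.map (conjLocal E c v))ᵀ * gramS F E v 2 T₀ + gramS F E v 2 T₀ * β = 0)
    (ht : (t.map (conjLocal E c v))ᵀ * gramS F E v 2 T₀ + gramS F E v 2 T₀ * t = 0)
    {b Y : Matrix (Fin 2) (Fin 2) (v.adicCompletion F)} (hb : ∀ i j, toPlace v w₀ (b i j) = β i j w₀) (hY : ∀ i j, toPlace v w₀ (Y i j) = t i j w₀) :
    τ (Matrix.trace (β * t)) = 2 * Matrix.trace (b * Y) := by
  have hT := isUnit_det_gramS' F E v 2 hT₀d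
  have hTt := gramS_transpose F E v 2 hT₀
  -- `tr(βt)` is `σ`-fixed
  have hfix : conjLocal E c v (Matrix.trace (β * t)) = Matrix.trace (β * t) := by
    rw [show conjLocal E c v (Matrix.trace (β * t)) = Matrix.trace ((β * t).map (conjLocal E c v)) from
        AddMonoidHom.map_trace (conjLocal E c v : LocalRing E v →+* LocalRing E v) _,
      Matrix.map_mul, map_conj_eq_of_skew F E c v hT hTt hβ, map_conj_eq_of_skew F E c v hT hTt ht]
    calc Matrix.trace (-((gramS F E v 2 T₀)⁻¹ * βᵀ * gramS F E v 2 T₀) * -((gramS F E v 2 T₀)⁻¹ * tᵀ * gramS F E v 2 T₀))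
        = Matrix.trace ((gramS F E v 2 T₀)⁻¹ * (βᵀ * (gramS F E v 2 T₀ * (gramS F E v 2 T₀)⁻¹) * tᵀ) * gramS F E v 2 T₀) := by
          simp only [Matrix.neg_mul, Matrix.mul_neg, neg_neg, Matrix.mul_assoc]
      _ = Matrix.trace (βᵀ * tᵀ) := by
          rw [Matrix.mul_nonsing_inv _ hT, Matrix.mul_one, Matrix.trace_mul_cycle, Matrix.mul_nonsing_inv _ hT, Matrix.one_mul]
      _ = Matrix.trace (β * t) := by rw [← Matrix.transpose_mul, Matrix.trace_transpose, Matrix.trace_mul_comm]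
  -- read `ι_v(τ r) = r + σ r` at `w₀`
  have hw := congrFun (hτ (Matrix.trace (β * t))) w₀
  rw [toLocalRing_apply, hfix, Pi.add_apply, ← two_mul] at hw
  apply (toPlace v w₀).injective
  rw [hw, map_mul, map_ofNat]
  congr 1
  -- `(tr(βt))_{w₀} = ι_{w₀}(tr(bY))`
  rw [Matrix.trace, Matrix.trace, Finset.sum_apply, map_sum]
  refine Finset.sum_congr rfl fun i _ => ?_
  rw [Matrix.diag_apply, Matrix.diag_apply, Matrix.mul_apply, Matrix.mul_apply, Finset.sum_apply, map_sum]
  refine Finset.sum_congr rfl fun k _ => ?_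
  rw [Pi.mul_apply, map_mul, hb, hY]

end Summit.HodgeConjecture.HodgeConjecture.Cruxes.HLiu418.K2LiuSkewLatticeSplitTransport

end
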